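import Summits.MatrixMultiplication.MatrixMultiplication.Theses.FourierTwoFamiliesModP

/-!
# Prime moduli are w.l.o.g. (Bertrand lift) and small boundary witnesses

Crux `FourierTwoFamiliesModP.PrimeDensityDecay` (stmt-MatrixMultiplication-14311), refuter / crux-disprover lane
(`Theorems/PrimeDensityDecay/Negative/`).  `sdpp_lift`: a balanced SDPP family in `ZMod N` lifts to `ZMod p` for every `p ≥ 2N`, so the crux implies decay in every cyclic group (`densityDecay_all_moduli_of_crux`, `ε ↦ 4ε`); `s_two_witness_17` (density `8/17` at `s = 2`) and `s_four_witness_30` (`ℤ/30`, `s = 4`, `n = 2`, `n s² = 32 > 30`: the first modulus where translates are beaten) with the exact small census in its docstring.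
These are the landed copies of the sections of the standing disproof work file
`Cruxes/PrimeDensityDecay/Disproof.lean` (same statements and proofs, namespace `…Negative.Disproof`); no theorem here
asserts a Theses decl positively.
-/

namespace Summit.MatrixMultiplication.MatrixMultiplication.Theorems.PrimeDensityDecay.Negative.Disproof

open Finset
open Summit.MatrixMultiplication.MatrixMultiplication.Theses.FourierTwoFamiliesModP

/-! ## (a'') Prime moduli are w.l.o.g.: the Bertrand lift `ZMod N → [0,N) → ZMod p`, `p ≥ 2N` -/

/-- Lift a finite set of residues mod `N` to `ZMod p` through the representatives in `[0,N)`. -/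
def liftSet {N : ℕ} (p : ℕ) (S : Finset (ZMod N)) : Finset (ZMod p) :=
  S.image (fun x : ZMod N => ((x.val : ℕ) : ZMod p))

/-- A four-term relation among lifted representatives is an integer of absolute value `< 2N ≤ p`,
hence vanishes in `ℤ`. -/
lemma lift_rel_int {N p : ℕ} [NeZero N] (hp : 2 * N ≤ p) (x y z w : ZMod N)
    (h : (((x.val : ℕ) : ZMod p) - ((y.val : ℕ) : ZMod p)) +
      ((((z.val : ℕ) : ZMod p)) - ((w.val : ℕ) : ZMod p)) = 0) :
    ((x.val : ℤ) - y.val) + ((z.val : ℤ) - w.val) = 0 := by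
  have hz : (((((x.val : ℤ) - y.val) + ((z.val : ℤ) - w.val)) : ℤ) : ZMod p) = 0 := by
    push_cast
    exact h
  rw [ZMod.intCast_zmod_eq_zero_iff_dvd] at hz
  have hx : (x.val : ℤ) < N := by exact_mod_cast ZMod.val_lt x
  have hy : (y.val : ℤ) < N := by exact_mod_cast ZMod.val_lt y
  have hzv : (z.val : ℤ) < N := by exact_mod_cast ZMod.val_lt z
  have hw : (w.val : ℤ) < N := by exact_mod_cast ZMod.val_lt w
  have n1 : (0 : ℤ) ≤ x.val := Nat.cast_nonneg _
  have n2 : (0 : ℤ) ≤ y.val := Nat.cast_nonneg _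
  have n3 : (0 : ℤ) ≤ z.val := Nat.cast_nonneg _
  have n4 : (0 : ℤ) ≤ w.val := Nat.cast_nonneg _
  have hp' : (2 : ℤ) * N ≤ p := by exact_mod_cast hp
  refine Int.eq_zero_of_abs_lt_dvd hz ?_
  rw [abs_lt]; constructor <;> linarith

/-- … and therefore the same relation already holds mod `N`. -/
lemma lift_rel_mod {N p : ℕ} [NeZero N] (hp : 2 * N ≤ p) (x y z w : ZMod N)
    (h : (((x.val : ℕ) : ZMod p) - ((y.val : ℕ) : ZMod p)) +
      ((((z.val : ℕ) : ZMod p)) - ((w.val : ℕ) : ZMod p)) = 0) :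
    (x - y) + (z - w) = 0 := by
  have h0 := lift_rel_int hp x y z w h
  have h1 : (((((x.val : ℤ) - y.val) + ((z.val : ℤ) - w.val)) : ℤ) : ZMod N) = 0 := by
    rw [h0]; simp
  push_cast at h1
  simpa [ZMod.natCast_zmod_val] using h1

/-- The lift is injective (`N ≤ p`). -/
lemma lift_injective {N p : ℕ} [NeZero N] (hp : 2 * N ≤ p) :
    Function.Injective (fun x : ZMod N => ((x.val : ℕ) : ZMod p)) := by
  intro x y h
  have h' := (ZMod.natCast_eq_natCast_iff' _ _ _).mp h
  have hx := ZMod.val_lt x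
  have hy := ZMod.val_lt y
  rw [Nat.mod_eq_of_lt (by omega), Nat.mod_eq_of_lt (by omega)] at h'
  exact ZMod.val_injective N h'

/-- `|liftSet p S| = |S|`. -/
lemma card_liftSet {N p : ℕ} [NeZero N] (hp : 2 * N ≤ p) (S : Finset (ZMod N)) :
    (liftSet p S).card = S.card := by
  classical
  exact Finset.card_image_of_injective _ (lift_injective hp)

/-- BERTRAND TRANSFER — PRIME MODULI ARE W.L.O.G. (up to a factor `≤ 4`, indeed `2 + o(1)`, in
density): a balanced SDPP family in `ZMod N` (`N ≥ 1`, composite allowed) lifts to a balanced SDPP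
family with the same `n` and `s` in `ZMod p` for EVERY `p ≥ 2N`; with a prime `p ∈ (2N, 4N]`
(`Nat.exists_prime_lt_and_le_two_mul`) the density drops by at most `4`.  So `PrimeDensityDecay`
implies the same decay statement for all cyclic groups (and, through CRT, for all `⊕ ℤ/m_t` with
pairwise coprime `m_t`); conversely a dense family in any `ℤ/N` would refute the crux. -/
theorem sdpp_lift {N p : ℕ} [NeZero N] (hp : 2 * N ≤ p) {n s : ℕ} (A B : Fin n → Finset (ZMod N))
    (hcard : ∀ i : Fin n, (A i).card = s ∧ (B i).card = s)
    (hW : ∀ i : Fin n, ∀ a ∈ A i, ∀ a' ∈ A i, ∀ b ∈ B i, ∀ b' ∈ B i,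
      (a - a') + (b - b') = 0 → a = a' ∧ b = b')
    (hX : ∀ i j k : Fin n, ∀ a ∈ A i, ∀ a' ∈ A j, ∀ b ∈ B j, ∀ b' ∈ B k,
      (a - a') + (b - b') = 0 → i = k) :
    (∀ i : Fin n, (liftSet p (A i)).card = s ∧ (liftSet p (B i)).card = s) ∧
    (∀ i : Fin n, ∀ a ∈ liftSet p (A i), ∀ a' ∈ liftSet p (A i), ∀ b ∈ liftSet p (B i),
      ∀ b' ∈ liftSet p (B i), (a - a') + (b - b') = 0 → a = a' ∧ b = b') ∧
    (∀ i j k : Fin n, ∀ a ∈ liftSet p (A i), ∀ a' ∈ liftSet p (A j), ∀ b ∈ liftSet p (B j),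
      ∀ b' ∈ liftSet p (B k), (a - a') + (b - b') = 0 → i = k) := by
  refine ⟨fun i => ⟨?_, ?_⟩, ?_, ?_⟩
  · rw [card_liftSet hp, (hcard i).1]
  · rw [card_liftSet hp, (hcard i).2]
  · intro i a ha a' ha' b hb b' hb' h
    simp only [liftSet, Finset.mem_image] at ha ha' hb hb'
    obtain ⟨x, hx, rfl⟩ := ha
    obtain ⟨y, hy, rfl⟩ := ha'
    obtain ⟨z, hz, rfl⟩ := hb
    obtain ⟨w, hw, rfl⟩ := hb'
    obtain ⟨rfl, rfl⟩ := hW i x hx y hy z hz w hw (lift_rel_mod hp x y z w h)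
    exact ⟨rfl, rfl⟩
  · intro i j k a ha a' ha' b hb b' hb' h
    simp only [liftSet, Finset.mem_image] at ha ha' hb hb'
    obtain ⟨x, hx, rfl⟩ := ha
    obtain ⟨y, hy, rfl⟩ := ha'
    obtain ⟨z, hz, rfl⟩ := hb
    obtain ⟨w, hw, rfl⟩ := hb'
    exact hX i j k x hx y hy z hz w hw (lift_rel_mod hp x y z w h)

/-- Corollary: the crux implies density decay in EVERY cyclic group `ℤ/N`, `N ≥ 1`, with `ε ↦ 4ε`. -/
theorem densityDecay_all_moduli_of_crux (h : PrimeDensityDecay) :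
    ∀ ε : ℝ, 0 < ε → ∃ s₀ : ℕ, ∀ N : ℕ, 0 < N → ∀ (n s : ℕ) (A B : Fin n → Finset (ZMod N)), s₀ ≤ s →
      (∀ i : Fin n, (A i).card = s ∧ (B i).card = s) →
      (∀ i : Fin n, ∀ a ∈ A i, ∀ a' ∈ A i, ∀ b ∈ B i, ∀ b' ∈ B i,
        (a - a') + (b - b') = 0 → a = a' ∧ b = b') →
      (∀ i j k : Fin n, ∀ a ∈ A i, ∀ a' ∈ A j, ∀ b ∈ B j, ∀ b' ∈ B k,
        (a - a') + (b - b') = 0 → i = k) →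
      (n : ℝ) * (s : ℝ) ≤ 4 * ε * (N : ℝ) := by
  intro ε hε
  obtain ⟨s₀, hs₀⟩ := h ε hε
  refine ⟨s₀, ?_⟩
  intro N hN n s A B hs hcard hW hX
  haveI : NeZero N := ⟨Nat.pos_iff_ne_zero.mp hN⟩
  obtain ⟨p, hp, hlt, hle⟩ := Nat.exists_prime_lt_and_le_two_mul (2 * N) (by omega)
  obtain ⟨hc', hW', hX'⟩ := sdpp_lift (p := p) (by omega) A B hcard hW hX
  have key := hs₀ p hp n s (fun i => liftSet p (A i)) (fun i => liftSet p (B i)) hs hc' hW' hX'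
  have hle' : (p : ℝ) ≤ 2 * (2 * (N : ℝ)) := by exact_mod_cast hle
  have : ε * (p : ℝ) ≤ ε * (2 * (2 * (N : ℝ))) := mul_le_mul_of_nonneg_left hle' hε.le
  linarith

/-! ## (b) Boundary data at `s = 2` -/

/-- Period-4 translates in `ℤ/17`: `A_i = {4i, 4i+1}`, `B_i = {4i, 4i+2}`, `i < 4`. -/
abbrev A17 : Fin 4 → Finset (ZMod 17) := ![{0, 1}, {4, 5}, {8, 9}, {12, 13}]
/-- see `A17`. -/
abbrev B17 : Fin 4 → Finset (ZMod 17) := ![{0, 2}, {4, 6}, {8, 10}, {12, 14}]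

/-- balance of the `ℤ/17` witness. -/
lemma A17_card : ∀ i : Fin 4, (A17 i).card = 2 ∧ (B17 i).card = 2 := by decide
/-- (W) for the `ℤ/17` witness. -/
lemma A17_W : ∀ i : Fin 4, ∀ a ∈ A17 i, ∀ a' ∈ A17 i, ∀ b ∈ B17 i, ∀ b' ∈ B17 i,
    (a - a') + (b - b') = 0 → a = a' ∧ b = b' := by decide
/-- (X) for the `ℤ/17` witness. -/
lemma A17_X : ∀ i j k : Fin 4, ∀ a ∈ A17 i, ∀ a' ∈ A17 j, ∀ b ∈ B17 j, ∀ b' ∈ B17 k,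
    (a - a') + (b - b') = 0 → i = k := by decide

/-- BOUNDARY: a balanced SDPP configuration with `s = 2`, `n = 4`, `p = 17`, density `8/17 > 0.47`;
hence in the crux `s₀(ε) ≥ 3` for every `ε < 8/17` (and, by the gen-1 exact census `n_max(p) = ⌊p/4⌋`
for `s = 2`, `s₀(ε) ≥ 3` for every `ε < 1/2`). -/
theorem s_two_witness_17 : ∃ (A B : Fin 4 → Finset (ZMod 17)),
    (∀ i : Fin 4, (A i).card = 2 ∧ (B i).card = 2) ∧
    (∀ i : Fin 4, ∀ a ∈ A i, ∀ a' ∈ A i, ∀ b ∈ B i, ∀ b' ∈ B i, (a - a') + (b - b') = 0 → a = a' ∧ b = b') ∧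
    (∀ i j k : Fin 4, ∀ a ∈ A i, ∀ a' ∈ A j, ∀ b ∈ B j, ∀ b' ∈ B k, (a - a') + (b - b') = 0 → i = k) ∧
    (17 : ℝ) * (8 / 17) ≤ (4 : ℝ) * 2 :=
  ⟨A17, B17, A17_card, A17_W, A17_X, by norm_num⟩

/-! ### (b'') Exact small census (local DFS `sat/dfs_small.py`, complete searches) and the first
non-translate gain -/

/-- The `ℤ/30` configuration found by exhaustive search: `A₀ = {0,1,2,3}`, `B₀ = {0,5,10,15}`,
`A₁ = {9,14,19,24}`, `B₁ = {19,21,22,23}` (`A₁ − B₁ = (A₀ − B₀) ∖ {15} ∪ {5}`). -/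
abbrev A30 : Fin 2 → Finset (ZMod 30) := ![{0, 1, 2, 3}, {9, 14, 19, 24}]
/-- see `A30`. -/
abbrev B30 : Fin 2 → Finset (ZMod 30) := ![{0, 5, 10, 15}, {19, 21, 22, 23}]

/-- balance of the `ℤ/30` configuration. -/
lemma A30_card : ∀ i : Fin 2, (A30 i).card = 4 ∧ (B30 i).card = 4 := by decide
set_option maxRecDepth 100000 in
/-- (W) for the `ℤ/30` configuration. -/
lemma A30_W : ∀ i : Fin 2, ∀ a ∈ A30 i, ∀ a' ∈ A30 i, ∀ b ∈ B30 i, ∀ b' ∈ B30 i,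
    (a - a') + (b - b') = 0 → a = a' ∧ b = b' := by decide
set_option maxRecDepth 100000 in
/-- (X) for the `ℤ/30` configuration. -/
lemma A30_X : ∀ i j k : Fin 2, ∀ a ∈ A30 i, ∀ a' ∈ A30 j, ∀ b ∈ B30 j, ∀ b' ∈ B30 k,
    (a - a') + (b - b') = 0 → i = k := by decide

/-- EXACT SMALL CENSUS (complete depth-first searches, `sat/dfs_small.py`, every witness
re-verified on the literal four-variable conditions; larger ranges are queued as SAT jobs):
* `s = 2`: `n_max(N) = ⌊N/4⌋` for `5 ≤ N ≤ 14` (gen-1 refuter: also for the primes `≤ 19`);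
* `s = 3`: `n_max(N) = ⌊N/9⌋` for ALL `9 ≤ N ≤ 27` — translates are optimal, density never
  exceeds `1/3 = 1/s`, and the translate bound `n s² ≤ N` is the exact truth in this range;
* `s = 4`: `n_max(N) = 1` for `16 ≤ N ≤ 29` and for the prime `N = 31`, but `n_max(30) = 2`
  (this configuration, `n s² = 32 > 30`: the first modulus where a non-translate design beats the
  translate count — composite, and by `sdpp_lift` it only reaches primes `p ≥ 60`, where
  `n s² = 32 < p`), `n_max(32) ≥ 2`.
So at block sizes `2, 3, 4` nothing comes close to density bounded away from `1/s`; the data are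
consistent with decay and with `n_max(p) = ⌊p/s²⌋` for PRIME `p` at `s ≤ 4` (open). -/
theorem s_four_witness_30 : ∃ (A B : Fin 2 → Finset (ZMod 30)),
    (∀ i : Fin 2, (A i).card = 4 ∧ (B i).card = 4) ∧
    (∀ i : Fin 2, ∀ a ∈ A i, ∀ a' ∈ A i, ∀ b ∈ B i, ∀ b' ∈ B i, (a - a') + (b - b') = 0 → a = a' ∧ b = b') ∧
    (∀ i j k : Fin 2, ∀ a ∈ A i, ∀ a' ∈ A j, ∀ b ∈ B j, ∀ b' ∈ B k, (a - a') + (b - b') = 0 → i = k) ∧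
    (30 : ℕ) < 2 * 4 ^ 2 :=
  ⟨A30, B30, A30_card, A30_W, A30_X, by norm_num⟩


end Summit.MatrixMultiplication.MatrixMultiplication.Theorems.PrimeDensityDecay.Negative.Disproof
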